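import Summits.ValiantsHypothesis.ValiantsHypothesis.Theorems.NewtonFramesTwoProductsFrameRungTwoTrinomial

/-!
# Crux `TwoProducts` (stmt-5906), line `FrameRungTwo`: the open stub at `k ≤ 2` for ALL parallelogram-free frames (any `t`)

Sequel to `…FrameRungTwoTrinomial.lean`.  The trinomial files never used the letter bound `t ≤ 3` except in the final
arithmetic: the rigidity lemma (`matched_three`), the vertex form (`vertex_form_three`: an uncancelled vertex word demotes
`≤ 1` letter of its top tuple, or the vertex is the common top minus two gaps of ONE coordinate of the other frame) and the
covering sets (`card_cover_le`, `card_cover2_le`) hold for letter sets of ANY size, as long as both dissociated frames have NO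
PARALLELOGRAM COINCIDENCE (no word sum equals another word sum shifted by `x + y − 2c` for three distinct letters `c, x, y`
of one coordinate, `c` the letter the second word uses there).  Hence:

* `crossCancel_noParallelogram` — one product on each of two parallelogram-free dissociated frames, `≤ t` letters per
  coordinate, ANY `t`: cross-cancelling vertices `≤ (m t + 2)^6`;
* `crossCancelCount_le_two_of_noParallelogram` — the registered stub `stub_crossCancelCount` VERBATIM for `k ≤ 2` and all
  `t`, plus the no-parallelogram hypothesis on both frames (`C = 6`).

So at `k = 2` the stub (and its algebra-free core (SD)) can only fail on frames WITH parallelogram coincidences — the carry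
mechanism; among those, all arithmetic-progression frames are polynomial by `…TwoProductsAPSupports.lean`.
Honest scope: the `k ≤ 2` layer of ONE stub of a rung strictly below the crux `TwoProducts`, on generic (coincidence-free)
frames; nothing here bears on the crux in general or on `VP ≠ VNP`. [ours; setting KPTT arXiv:1308.2286 §2, §5]
-/

set_option linter.dupNamespace false

namespace Summit.ValiantsHypothesis.ValiantsHypothesis.Theorems.NewtonFramesTwoProducts.FrameRungTwoTrinomial

open MvPolynomial
open scoped BigOperators Classical
open Summit.ValiantsHypothesis.Theorems.DissociatedFixedK (lexKey lexKey_injective lexTop lexTop_mem lexKey_le_lexTop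
  stub_topTupleCount count_arith)
open Summit.ValiantsHypothesis.ValiantsHypothesis.Theorems.DissociatedFixedK.Negative (emb emb_injective)
open Summit.ValiantsHypothesis.ValiantsHypothesis.Theorems.NewtonFramesTwoProducts.FrameRungTwoBinomial
  (emb_add emb_sum lexKey_sum apply_le_of_lexKey_le lexKey_lt_of_apply_lt lexKey_sum_lt_sum lexKey_sum_le_sum
   eq_T_of_not_mem_filter ne_T_of_mem_filter lexKey_sum_lt_T lexKey_sum_le_T coeff_word exists_word prod_coeff_ne_zero
   top_eq mem_cover card_cover_le cross_empty_of_union_subset support_filter_sum_subset_one)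

noncomputable section

section Main

variable {m : ℕ}

/-- The final arithmetic, any `t`. -/
theorem count_arith_all (m t : ℕ) :
    2 * ((m * t + 1) * (4 * (m * t) ^ 2 + 7)) + 2 * ((4 * (m * t) ^ 2 + 7) * (m * (t * t))) ≤ (m * t + 2) ^ 6 := by
  set X := m * t with hX
  have h1 : m * (t * t) ≤ X * (X + 2) := by
    rcases Nat.eq_zero_or_pos m with hm | hm
    · subst hm; simp
    · have ht : t ≤ m * t + 2 := by
        calc t = 1 * t := (one_mul t).symm
          _ ≤ m * t := Nat.mul_le_mul_right t hm
          _ ≤ m * t + 2 := Nat.le_add_right _ _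
      rw [hX, ← mul_assoc]; exact Nat.mul_le_mul_left _ ht
  calc 2 * ((X + 1) * (4 * X ^ 2 + 7)) + 2 * ((4 * X ^ 2 + 7) * (m * (t * t)))
      ≤ 2 * ((X + 1) * (4 * X ^ 2 + 7)) + 2 * ((4 * X ^ 2 + 7) * (X * (X + 2))) := by gcongr
    _ ≤ 2 * ((X + 1) * (4 * X ^ 2 + 7)) + 2 * ((4 * X ^ 2 + 7) * (X * (X + 2))) +
        (X ^ 6 + 12 * X ^ 5 + 52 * X ^ 4 + 136 * X ^ 3 + 218 * X ^ 2 + 150 * X + 50) := Nat.le_add_right _ _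
    _ = (X + 2) ^ 6 := by ring

/-- **Cross-cancelling vertices for two parallelogram-free dissociated frames** (one product on each frame, `≤ t` letters
per coordinate, any `t`): at most `(m t + 2)^6`. [ours; setting KPTT arXiv:1308.2286 §2] -/
theorem crossCancel_noParallelogram (m t : ℕ) (A B : Fin m → Finset (Fin 2 →₀ ℕ))
    (f g : Fin m → MvPolynomial (Fin 2) ℂ)
    (hA : ∀ j, (A j).card ≤ t) (hB : ∀ j, (B j).card ≤ t)
    (hf : ∀ j, (f j).support ⊆ A j) (hg : ∀ j, (g j).support ⊆ B j)
    (hinjA : ∀ a b : Fin m → (Fin 2 →₀ ℕ), (∀ j, a j ∈ A j) → (∀ j, b j ∈ A j) → ∑ j, a j = ∑ j, b j → a = b)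
    (hinjB : ∀ a b : Fin m → (Fin 2 →₀ ℕ), (∀ j, a j ∈ B j) → (∀ j, b j ∈ B j) → ∑ j, a j = ∑ j, b j → a = b)
    (hparA : ∀ (a a' : Fin m → (Fin 2 →₀ ℕ)) (p : Fin m) (x y : Fin 2 →₀ ℕ), (∀ j, a j ∈ A j) → (∀ j, a' j ∈ A j) →
      x ∈ A p → y ∈ A p → x ≠ y → x ≠ a' p → y ≠ a' p → (∑ j, a j) + a' p + a' p ≠ (∑ j, a' j) + x + y)
    (hparB : ∀ (a a' : Fin m → (Fin 2 →₀ ℕ)) (p : Fin m) (x y : Fin 2 →₀ ℕ), (∀ j, a j ∈ B j) → (∀ j, a' j ∈ B j) →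
      x ∈ B p → y ∈ B p → x ≠ y → x ≠ a' p → y ≠ a' p → (∑ j, a j) + a' p + a' p ≠ (∑ j, a' j) + x + y) :
    {p : Fin 2 → ℝ | p ∈ Set.extremePoints ℝ (convexHull ℝ
          (emb '' ((∏ j, f j + ∏ j, g j).support : Set (Fin 2 →₀ ℕ)))) ∧
        ∃ l : (Fin 2 → ℝ) →ₗ[ℝ] ℝ,
          (∀ q ∈ emb '' ((∏ j, f j + ∏ j, g j).support : Set (Fin 2 →₀ ℕ)), q ≠ p → l q < l p) ∧
          ∃ q ∈ emb '' ((∏ j, f j).support : Set (Fin 2 →₀ ℕ)) ∪ emb '' ((∏ j, g j).support : Set (Fin 2 →₀ ℕ)),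
            l p < l q}.ncard ≤ (m * t + 2) ^ 6 := by
  by_cases h0 : (∀ j, f j ≠ 0) ∧ (∀ j, g j ≠ 0)
  swap
  · have hsub : (∏ j, f j).support ∪ (∏ j, g j).support ⊆ (∏ j, f j + ∏ j, g j).support := by
      rw [not_and_or] at h0
      rcases h0 with h | h
      · push Not at h
        obtain ⟨j, hj⟩ := h
        rw [Finset.prod_eq_zero (Finset.mem_univ j) hj, support_zero, Finset.empty_union, zero_add]
      · push Not at h
        obtain ⟨j, hj⟩ := h
        rw [Finset.prod_eq_zero (Finset.mem_univ j) hj, support_zero, Finset.union_empty, add_zero]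
    rw [cross_empty_of_union_subset _ _ _ hsub, Set.ncard_empty]
    exact Nat.zero_le _
  obtain ⟨hf0, hg0⟩ := h0
  have hnef : ∀ j, ((f j).support).Nonempty := fun j => by
    rw [Finset.nonempty_iff_ne_empty, Ne, MvPolynomial.support_eq_empty]; exact hf0 j
  have hneg : ∀ j, ((g j).support).Nonempty := fun j => by
    rw [Finset.nonempty_iff_ne_empty, Ne, MvPolynomial.support_eq_empty]; exact hg0 j
  have hSf : ∀ j, ((f j).support).card ≤ t := fun j => (Finset.card_le_card (hf j)).trans (hA j)
  have hSg : ∀ j, ((g j).support).card ≤ t := fun j => (Finset.card_le_card (hg j)).trans (hB j)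
  have hinjf : ∀ a b : Fin m → (Fin 2 →₀ ℕ), (∀ j, a j ∈ (f j).support) → (∀ j, b j ∈ (f j).support) →
      ∑ j, a j = ∑ j, b j → a = b := fun a b ha hb => hinjA a b (fun j => hf j (ha j)) (fun j => hf j (hb j))
  have hinjg : ∀ a b : Fin m → (Fin 2 →₀ ℕ), (∀ j, a j ∈ (g j).support) → (∀ j, b j ∈ (g j).support) →
      ∑ j, a j = ∑ j, b j → a = b := fun a b ha hb => hinjB a b (fun j => hg j (ha j)) (fun j => hg j (hb j))
  -- covering finsets
  set U1f : Finset (Fin 2 → ℝ) := ((Fintype.piFinset fun j => (f j).support).filter fun b =>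
        ∃ l : (Fin 2 → ℝ) →L[ℝ] ℝ, ∀ j, ∀ x ∈ (f j).support, lexKey l x ≤ lexKey l (b j)).biUnion fun b =>
      (Finset.insertNone (Finset.univ.biUnion fun j => ((f j).support).image (Prod.mk j))).image fun o =>
        emb (∑ j, Option.elim o b (fun p => Function.update b p.1 p.2) j) with hU1f
  set U1g : Finset (Fin 2 → ℝ) := ((Fintype.piFinset fun j => (g j).support).filter fun b =>
        ∃ l : (Fin 2 → ℝ) →L[ℝ] ℝ, ∀ j, ∀ x ∈ (g j).support, lexKey l x ≤ lexKey l (b j)).biUnion fun b =>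
      (Finset.insertNone (Finset.univ.biUnion fun j => ((g j).support).image (Prod.mk j))).image fun o =>
        emb (∑ j, Option.elim o b (fun p => Function.update b p.1 p.2) j) with hU1g
  set U2f : Finset (Fin 2 → ℝ) := ((Fintype.piFinset fun j => (f j).support).filter fun b =>
        ∃ l : (Fin 2 → ℝ) →L[ℝ] ℝ, ∀ j, ∀ x ∈ (f j).support, lexKey l x ≤ lexKey l (b j)).biUnion fun b =>
      Finset.univ.biUnion fun p => (((f p).support) ×ˢ ((f p).support)).image fun yy =>
        emb (∑ j, b j) - (emb (b p) - emb yy.1) - (emb (b p) - emb yy.2) with hU2f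
  set U2g : Finset (Fin 2 → ℝ) := ((Fintype.piFinset fun j => (g j).support).filter fun b =>
        ∃ l : (Fin 2 → ℝ) →L[ℝ] ℝ, ∀ j, ∀ x ∈ (g j).support, lexKey l x ≤ lexKey l (b j)).biUnion fun b =>
      Finset.univ.biUnion fun p => (((g p).support) ×ˢ ((g p).support)).image fun yy =>
        emb (∑ j, b j) - (emb (b p) - emb yy.1) - (emb (b p) - emb yy.2) with hU2g
  have hmem2 : ∀ (lc : (Fin 2 → ℝ) →L[ℝ] ℝ) (g' : Fin m → MvPolynomial (Fin 2) ℂ) (T' : Fin m → (Fin 2 →₀ ℕ)),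
      (∀ j, T' j ∈ (g' j).support) → (∀ j, ∀ x ∈ (g' j).support, lexKey lc x ≤ lexKey lc (T' j)) →
      ∀ (p : Fin m) (y₁ y₂ : Fin 2 →₀ ℕ), y₁ ∈ (g' p).support → y₂ ∈ (g' p).support →
      emb (∑ j, T' j) - (emb (T' p) - emb y₁) - (emb (T' p) - emb y₂) ∈
        ((Fintype.piFinset fun j => (g' j).support).filter fun b =>
          ∃ l : (Fin 2 → ℝ) →L[ℝ] ℝ, ∀ j, ∀ x ∈ (g' j).support, lexKey l x ≤ lexKey l (b j)).biUnion fun b =>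
        Finset.univ.biUnion fun p => (((g' p).support) ×ˢ ((g' p).support)).image fun yy =>
          emb (∑ j, b j) - (emb (b p) - emb yy.1) - (emb (b p) - emb yy.2) := by
    intro lc g' T' hT' hTmax' p y₁ y₂ hy₁ hy₂
    refine Finset.mem_biUnion.2 ⟨T', Finset.mem_filter.2 ⟨Fintype.mem_piFinset.2 hT', lc, hTmax'⟩, ?_⟩
    refine Finset.mem_biUnion.2 ⟨p, Finset.mem_univ _, Finset.mem_image.2 ⟨(y₁, y₂), ?_, rfl⟩⟩
    exact Finset.mem_product.2 ⟨hy₁, hy₂⟩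
  have hcover : {p : Fin 2 → ℝ | p ∈ Set.extremePoints ℝ (convexHull ℝ
          (emb '' ((∏ j, f j + ∏ j, g j).support : Set (Fin 2 →₀ ℕ)))) ∧
        ∃ l : (Fin 2 → ℝ) →ₗ[ℝ] ℝ,
          (∀ q ∈ emb '' ((∏ j, f j + ∏ j, g j).support : Set (Fin 2 →₀ ℕ)), q ≠ p → l q < l p) ∧
          ∃ q ∈ emb '' ((∏ j, f j).support : Set (Fin 2 →₀ ℕ)) ∪ emb '' ((∏ j, g j).support : Set (Fin 2 →₀ ℕ)),
            l p < l q} ⊆ ↑((U1f ∪ U1g) ∪ (U2f ∪ U2g)) := by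
    rintro p ⟨hp, l, hl, q, hq, hlt⟩
    obtain ⟨e, he, rfl⟩ := extremePoints_convexHull_subset hp
    have he' : e ∈ (∏ j, f j + ∏ j, g j).support := he
    set lc : (Fin 2 → ℝ) →L[ℝ] ℝ := LinearMap.toContinuousLinearMap l with hlc
    have hlcl : ∀ v, lc v = l v := fun v => rfl
    -- key-top tuples
    set T : Fin m → (Fin 2 →₀ ℕ) := fun j => lexTop lc ((f j).support) (hnef j) with hTdef
    set T' : Fin m → (Fin 2 →₀ ℕ) := fun j => lexTop lc ((g j).support) (hneg j) with hT'def
    have hT : ∀ j, T j ∈ (f j).support := fun j => lexTop_mem _ _ _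
    have hT' : ∀ j, T' j ∈ (g j).support := fun j => lexTop_mem _ _ _
    have hTmax : ∀ j, ∀ x ∈ (f j).support, lexKey lc x ≤ lexKey lc (T j) := fun j x hx => lexKey_le_lexTop _ _ _ hx
    have hTmax' : ∀ j, ∀ x ∈ (g j).support, lexKey lc x ≤ lexKey lc (T' j) := fun j x hx => lexKey_le_lexTop _ _ _ hx
    have hparf : ∀ (a : Fin m → (Fin 2 →₀ ℕ)) (p : Fin m) (x y : Fin 2 →₀ ℕ), (∀ j, a j ∈ (f j).support) →
        x ∈ (f p).support → y ∈ (f p).support → x ≠ y → x ≠ T p → y ≠ T p →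
        (∑ j, a j) + T p + T p ≠ (∑ j, T j) + x + y := fun a p x y ha hx hy hxy hxT hyT =>
      hparA a T p x y (fun j => hf j (ha j)) (fun j => hf j (hT j)) (hf p hx) (hf p hy) hxy hxT hyT
    have hparg : ∀ (a : Fin m → (Fin 2 →₀ ℕ)) (p : Fin m) (x y : Fin 2 →₀ ℕ), (∀ j, a j ∈ (g j).support) →
        x ∈ (g p).support → y ∈ (g p).support → x ≠ y → x ≠ T' p → y ≠ T' p →
        (∑ j, a j) + T' p + T' p ≠ (∑ j, T' j) + x + y := fun a p x y ha hx hy hxy hxT hyT =>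
      hparB a T' p x y (fun j => hg j (ha j)) (fun j => hg j (hT' j)) (hg p hx) (hg p hy) hxy hxT hyT
    have hzero : ∀ x : Fin 2 →₀ ℕ, x ≠ e → lc (emb e) ≤ lc (emb x) →
        coeff x (∏ j, f j) + coeff x (∏ j, g j) = 0 := by
      intro x hxe hle
      by_contra hne
      have hx : x ∈ (∏ j, f j + ∏ j, g j).support := by rw [mem_support_iff, coeff_add]; exact hne
      have h := hl (emb x) ⟨x, hx, rfl⟩ (fun h => hxe (emb_injective h))
      rw [hlcl, hlcl] at hle
      exact absurd h (not_lt.2 hle)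
    have hzero' : ∀ x : Fin 2 →₀ ℕ, x ≠ e → lc (emb e) ≤ lc (emb x) →
        coeff x (∏ j, g j) + coeff x (∏ j, f j) = 0 := fun x hx hle => by rw [add_comm]; exact hzero x hx hle
    have heF : coeff e (∏ j, f j) + coeff e (∏ j, g j) ≠ 0 := by
      rw [← coeff_add]; exact mem_support_iff.1 he'
    have heF' : coeff e (∏ j, g j) + coeff e (∏ j, f j) ≠ 0 := by rwa [add_comm]
    have htops : ∑ j, T j = ∑ j, T' j ∧ lexKey lc e < lexKey lc (∑ j, T j) := by
      rcases hq with ⟨x, hx, rfl⟩ | ⟨x, hx, rfl⟩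
      · exact top_eq lc f g T T' hT hTmax hT' hTmax' hinjf hinjg e hzero ⟨x, hx, by rwa [hlcl, hlcl]⟩
      · have h := top_eq lc g f T' T hT' hTmax' hT hTmax hinjg hinjf e hzero' ⟨x, hx, by rwa [hlcl, hlcl]⟩
        refine ⟨h.1.symm, ?_⟩
        rw [← h.1]; exact h.2
    obtain ⟨htop, hTe⟩ := htops
    have hTe' : lexKey lc e < lexKey lc (∑ j, T' j) := htop ▸ hTe
    rw [Finset.coe_union, Finset.coe_union, Finset.coe_union]
    rcases Finset.mem_union.1 (support_add he') with hef | heg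
    · obtain ⟨a, ha, hae⟩ := exists_word f hinjf hef
      rcases vertex_form_three lc f g T T' hT hTmax hT' hTmax' hinjf hinjg hparf hparg e hzero htop hTe ha hae heF with
        hc | ⟨p', y₁, y₂, hy₁, hy₂, -, -, -, hE⟩
      · rw [← hae]
        exact Or.inl (Or.inl (mem_cover lc f T hT hTmax a ha hc))
      · rw [hE]
        exact Or.inr (Or.inr (hmem2 lc g T' hT' hTmax' p' y₁ y₂ hy₁ hy₂))
    · obtain ⟨a, ha, hae⟩ := exists_word g hinjg heg
      rcases vertex_form_three lc g f T' T hT' hTmax' hT hTmax hinjg hinjf hparg hparf e hzero' htop.symm hTe' ha hae heF'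
        with hc | ⟨p', y₁, y₂, hy₁, hy₂, -, -, -, hE⟩
      · rw [← hae]
        exact Or.inl (Or.inr (mem_cover lc g T' hT' hTmax' a ha hc))
      · rw [hE]
        exact Or.inr (Or.inl (hmem2 lc f T hT hTmax p' y₁ y₂ hy₁ hy₂))
  calc _ ≤ (↑((U1f ∪ U1g) ∪ (U2f ∪ U2g)) : Set (Fin 2 → ℝ)).ncard := Set.ncard_le_ncard hcover (Finset.finite_toSet _)
    _ = ((U1f ∪ U1g) ∪ (U2f ∪ U2g)).card := Set.ncard_coe_finset _
    _ ≤ (U1f.card + U1g.card) + (U2f.card + U2g.card) :=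
        (Finset.card_union_le _ _).trans (Nat.add_le_add (Finset.card_union_le _ _) (Finset.card_union_le _ _))
    _ ≤ ((m * t + 1) * (4 * (m * t) ^ 2 + 7) + (m * t + 1) * (4 * (m * t) ^ 2 + 7)) +
        ((4 * (m * t) ^ 2 + 7) * (m * (t * t)) + (4 * (m * t) ^ 2 + 7) * (m * (t * t))) :=
        Nat.add_le_add (Nat.add_le_add (card_cover_le t f hSf) (card_cover_le t g hSg))
          (Nat.add_le_add (card_cover2_le t f hSf) (card_cover2_le t g hSg))
    _ = 2 * ((m * t + 1) * (4 * (m * t) ^ 2 + 7)) + 2 * ((4 * (m * t) ^ 2 + 7) * (m * (t * t))) := by ring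
    _ ≤ (m * t + 2) ^ 6 := count_arith_all m t

end Main

/-! ## The registered stub for `k ≤ 2`, any `t`, frames without parallelogram coincidences -/

section Stub

/-- **`stub_crossCancelCount` for `k ≤ 2`, ALL `t`, frames WITHOUT PARALLELOGRAM COINCIDENCES**, with `C = 6`: the registered
stub of line `FrameRungTwo` (crux `TwoProducts`, stmt-5906) restricted to at most two products, under the extra hypothesis that
in each frame no word sum equals another word sum shifted by `x + y − 2c` for three distinct letters `c, x, y` of one coordinate
(`c` the letter used by the second word there); statement otherwise verbatim (no bound on `t` beyond the stub's own).
[ours; setting KPTT arXiv:1308.2286 §2] -/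
theorem crossCancelCount_le_two_of_noParallelogram : ∀ k ≤ 2, ∃ C : ℕ, ∀ (m t : ℕ),
    ∀ (A : Fin 2 → Fin m → Finset (Fin 2 →₀ ℕ)) (c : Fin k → Fin 2) (f : Fin k → Fin m → MvPolynomial (Fin 2) ℂ),
    (∀ σ j, (A σ j).card ≤ t) →
    (∀ i j, (f i j).support ⊆ A (c i) j) →
    (∀ σ, ∀ a b : Fin m → (Fin 2 →₀ ℕ), (∀ j, a j ∈ A σ j) → (∀ j, b j ∈ A σ j) →
        ∑ j, a j = ∑ j, b j → a = b) →
    (∀ σ, ∀ (a a' : Fin m → (Fin 2 →₀ ℕ)) (p : Fin m) (x y : Fin 2 →₀ ℕ), (∀ j, a j ∈ A σ j) → (∀ j, a' j ∈ A σ j) →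
        x ∈ A σ p → y ∈ A σ p → x ≠ y → x ≠ a' p → y ≠ a' p → (∑ j, a j) + a' p + a' p ≠ (∑ j, a' j) + x + y) →
    {p : Fin 2 → ℝ | p ∈ Set.extremePoints ℝ (convexHull ℝ (emb ''
          ((∑ i, ∏ j, f i j).support : Set (Fin 2 →₀ ℕ)))) ∧
        ∃ l : (Fin 2 → ℝ) →ₗ[ℝ] ℝ,
          (∀ q ∈ emb '' ((∑ i, ∏ j, f i j).support : Set (Fin 2 →₀ ℕ)), q ≠ p → l q < l p) ∧
          ∃ q ∈ emb '' ((∑ i ∈ Finset.univ.filter (fun i => c i = 0), ∏ j, f i j).support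
                          : Set (Fin 2 →₀ ℕ)) ∪
                 emb '' ((∑ i ∈ Finset.univ.filter (fun i => c i = 1), ∏ j, f i j).support
                          : Set (Fin 2 →₀ ℕ)),
            l p < l q}.ncard ≤ (m * t + 2) ^ C := by
  intro k hk
  refine ⟨6, ?_⟩
  intro m t A c f hA hf hinj hpar
  interval_cases k
  · rw [cross_empty_of_union_subset _ _ _ (by simp), Set.ncard_empty]
    exact Nat.zero_le _
  · rw [cross_empty_of_union_subset _ _ _ (Finset.union_subset (support_filter_sum_subset_one _)
      (support_filter_sum_subset_one _)), Set.ncard_empty]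
    exact Nat.zero_le _
  · by_cases hc : c 0 = c 1
    · have hsub : ∀ σ : Fin 2, (∑ i ∈ Finset.univ.filter (fun i => c i = σ), ∏ j, f i j).support ⊆
          (∑ i, ∏ j, f i j).support := by
        intro σ
        by_cases h : c 0 = σ
        · have : Finset.univ.filter (fun i => c i = σ) = Finset.univ := by
            ext i; fin_cases i <;> simp [h, ← hc]
          rw [this]
        · have : Finset.univ.filter (fun i => c i = σ) = ∅ := by
            ext i; fin_cases i <;> simp [h, ← hc]
          rw [this, Finset.sum_empty, support_zero]
          exact Finset.empty_subset _
      rw [cross_empty_of_union_subset _ _ _ (Finset.union_subset (hsub 0) (hsub 1)), Set.ncard_empty]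
      exact Nat.zero_le _
    · have hsum : (∑ i, ∏ j, f i j) = ∏ j, f 0 j + ∏ j, f 1 j := Fin.sum_univ_two _
      have key : ∀ x : Fin 2, x = 0 ∨ x = 1 := by decide
      rcases key (c 0) with h0 | h0 <;> rcases key (c 1) with h1 | h1
      · exact absurd (h0.trans h1.symm) hc
      · have e0 : (∑ i ∈ Finset.univ.filter (fun i => c i = 0), ∏ j, f i j) = ∏ j, f 0 j := by
          have : Finset.univ.filter (fun i => c i = 0) = {0} := by ext i; fin_cases i <;> simp [h0, h1]
          rw [this, Finset.sum_singleton]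
        have e1 : (∑ i ∈ Finset.univ.filter (fun i => c i = 1), ∏ j, f i j) = ∏ j, f 1 j := by
          have : Finset.univ.filter (fun i => c i = 1) = {1} := by ext i; fin_cases i <;> simp [h0, h1]
          rw [this, Finset.sum_singleton]
        rw [hsum, e0, e1]
        exact crossCancel_noParallelogram m t (A 0) (A 1) (f 0) (f 1) (hA 0) (hA 1)
          (fun j => by have := hf 0 j; rwa [h0] at this) (fun j => by have := hf 1 j; rwa [h1] at this)
          (hinj 0) (hinj 1) (hpar 0) (hpar 1)
      · have e0 : (∑ i ∈ Finset.univ.filter (fun i => c i = 0), ∏ j, f i j) = ∏ j, f 1 j := by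
          have : Finset.univ.filter (fun i => c i = 0) = {1} := by ext i; fin_cases i <;> simp [h0, h1]
          rw [this, Finset.sum_singleton]
        have e1 : (∑ i ∈ Finset.univ.filter (fun i => c i = 1), ∏ j, f i j) = ∏ j, f 0 j := by
          have : Finset.univ.filter (fun i => c i = 1) = {0} := by ext i; fin_cases i <;> simp [h0, h1]
          rw [this, Finset.sum_singleton]
        rw [hsum, e0, e1, add_comm]
        exact crossCancel_noParallelogram m t (A 0) (A 1) (f 1) (f 0) (hA 0) (hA 1)
          (fun j => by have := hf 1 j; rwa [h1] at this) (fun j => by have := hf 0 j; rwa [h0] at this)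
          (hinj 0) (hinj 1) (hpar 0) (hpar 1)
      · exact absurd (h0.trans h1.symm) hc

end Stub

end

end Summit.ValiantsHypothesis.ValiantsHypothesis.Theorems.NewtonFramesTwoProducts.FrameRungTwoTrinomial
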